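import Summits.SmoothPoincare4.SmoothPoincare4.Theses.EntropyRung
import Summits.SmoothPoincare4.SmoothPoincare4.Theorems.EntropyRungCompactShrinkerGapThresholdLiftRigidity
import Summits.SmoothPoincare4.SmoothPoincare4.Theorems.EntropyRungCompactShrinkerGapEinsteinEndgameKillingHopf
import HarnessLib

/-!
# Route EntropyRung — the THRESHOLD LIFT of crux `CompactShrinkerGap` (door Θ)

Crux stmt-SmoothPoincare4-10870 (`EntropyRung.CompactShrinkerGap`): a closed `M ≃ₕ S⁴` carrying a
normalised gradient shrinker `Ric + Hess f = g/2`, `R + |∇f|² = f` of Gaussian mass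
`Z := ∫ e^{-f} dV > 32π²√π e^{-3/2}` (density `Θ = Z/16π²` above `Θ(S³×ℝ) = .791`) is diffeomorphic
to `S⁴`. Twelve leads found its live content research-open behind every door (A: Weyl budget; A‴:
`Vol ≤ 96π² ∧ R ≤ 10`; E: Einstein; M: Morse; C: ν-summit).

**The lift.** In the route (`Theses/EntropyRung.lean`) the cut `ν_cyl = log Θ(S³×ℝ)` is a free
parameter: ENT (stmt-10871, "every homotopy 4-sphere carries `g₀` with `R > 0`, `ν(g₀) > cut`") is
equivalent to SPC4 at EVERY cut in `[ν_cyl, ν(S⁴_round)]` (true on `S⁴` by the round metric,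
`ν = log 6 − 2`; on an exotic `Σ` no construction is known at any cut), while RUNG's two density gaps
get WEAKER as the cut rises. At the top cut `ν(g₀) ≥ log Θ(S⁴) = log 6 − 2` the compact gap becomes

* COMPACT♯: a compact normalised shrinker on `M ≃ₕ S⁴` with `Z ≥ 96π² e^{-2}` (`Θ ≥ Θ(S⁴) = 6/e²`)
  lives on `M ≅ S⁴`

and this file proves, kernel-checked and with NO Chang–Gursky–Yang, NO Chern–Gauss–Bonnet, NO
sup-bound `R ≤ 10` and NO LP certificate (scalar and rigidity lemmas — `cylinderMass_lt_roundMass`,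
`helper_potentialEqTwo_of_jensenGe`, `hessian_const_four` — in the sibling
`EntropyRungCompactShrinkerGapThresholdLiftRigidity.lean`; the lifted route's bookkeeping RUNG♯ / ENT♯ /
NONCOMPACT♯ in `EntropyRungCompactShrinkerGapLiftedRoute.lean`):

* `helper_compactSharp_of_compactShrinkerGap` — `CompactShrinkerGap → COMPACT♯` (the lifted crux is
  WEAKER: `96π²e^{-2} > 32π²√π e^{-3/2}`, i.e. `√π e^{1/2} < 3`);
* `helper_volumeComparisonSharp_of_volumeComparison` — registered STUB 24 `stub_volumeComparison`
  (`Vol ≤ 96π²` for dense data) `→ VOLCOMP♯` (`Vol ≤ 96π²` for data with `Z ≥ 96π²e^{-2}`): weaker too;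
* `helper_thetaMaxSharp_of_volumeComparisonSharp` — `VOLCOMP♯ → ΘMAX♯`, where ΘMAX♯ is
  **Θ-maximality of the round sphere with rigidity**: for every compact normalised shrinker on a
  homotopy 4-sphere `Z ≤ 96π² e^{-2} = Z(S⁴(√6))`, and `Z ≥ 96π²e^{-2}` forces `Hess f ≡ 0`. Proof: the
  landed Jensen bound `Z ≤ e^{-2} Vol` (p71839, tangent line `(t−1)e^{-t} ≤ e^{-2}`) and `Vol ≤ 96π²`
  squeeze `Z = e^{-2}Vol`; then `∫ (e^{-2} − (f−1)e^{-f}) dV = 0` with a continuous non-negative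
  integrand and a measure positive on open sets (`isOpenPosMeasure_riemannianMeasure`) gives
  `(f−1)e^{-f} ≡ e^{-2}`, i.e. `f ≡ 2` (strict tangent line off `t = 2`), so `Hess f = Hess 2 = 0`;
* `helper_compactSharp_of_thetaMaxSharp` — `gursky_einstein_homotopySphere_four → ΘMAX♯ → COMPACT♯`
  (the landed Einstein endgame `helper_einsteinEndgameKillingHopf`, p131035: Gursky's gap + the volume
  floor + Killing–Hopf);
* `helper_thresholdLiftReduction` — `gursky_einstein_homotopySphere_four → VOLCOMP♯ → COMPACT♯`.

So under the lift the compact side of the route rests on ONE open statement of Bishop type,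
VOLCOMP♯ ⊂ VolumeComparison (true for Einstein shrinkers by Bishop's inequality; `≤ 72π²` on the known
compact zoo), or one step weaker on ΘMAX♯ — the exact Ricci twin of Colding–Ilmanen–Minicozzi–White's
theorem that round spheres MINIMISE Colding–Minicozzi entropy among closed self-shrinkers of the mean
curvature flow (J. Differential Geom. 95 (2013), Thm. 0.1). The lifted RUNG♯ ("`R > 0`,
`ν(g₀) ≥ log 6 − 2` on `M ≃ₕ S⁴` ⇒ `M ≅ S⁴`") needs, besides COMPACT♯, only NONCOMPACT♯ ("complete
non-compact non-flat shrinkers have `Θ < Θ(S⁴)`", weaker than the sibling crux stmt-10868) and the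
Bamler package, exactly as RUNG does; ENT♯ ("every `M ≃ₕ S⁴` carries `g₀` with `R > 0`,
`ν(g₀) ≥ log 6 − 2`") is true on `S⁴` and ⟺ SPC4, exactly as ENT is. Nothing here claims VOLCOMP♯ or
ΘMAX♯ is provable today: both are research-open (no printed bound of `Vol` or `Z` of a compact
non-Einstein 4-d shrinker is sharp at the round sphere); the point is that the lift removes the
EFFECTIVE constant (`Θ − Θ_cyl` margin, `R ≤ 10`) from the compact crux, in line with the margin
obstruction recorded by the twelfth lead.

References: H.-D. Cao, R. S. Hamilton, T. Ilmanen, arXiv:math/0404165 §4 [CaoHamiltonIlmanen2004];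
T. H. Colding, T. Ilmanen, W. P. Minicozzi II, B. White, J. Differential Geom. 95 (2013) 53–69, Thm. 0.1
[ColdingIlmanenMinicozziWhite2013]; M. J. Gursky, Math. Ann. 318 (2000), Thm. 1 [Gursky2000];
J. Carrillo, L. Ni, Comm. Anal. Geom. 17 (2009) §4 [CarrilloNi2009].
-/

-- the registered namespace `Summit.SmoothPoincare4.SmoothPoincare4.Theorems` repeats a component
set_option linter.dupNamespace false

noncomputable section

open MeasureTheory Set Function Filter
open scoped Manifold ContDiff Topology ContinuousMap

namespace Summit.SmoothPoincare4.SmoothPoincare4.Theorems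

open Literature.Geometry Literature.Geometry.Lorentzian Literature.Geometry.Riemannian
  Literature.Geometry.Lorentzian.PseudoRiemannianMetric
open Summit.SmoothPoincare4.SmoothPoincare4.Theses.EntropyRung
/-! ## The lifted statements and the reductions -/

/-- **VOLCOMP♯ ⇒ ΘMAX♯ (registered helper `helper_thetaMaxSharp_of_volumeComparisonSharp`).**
IF every compact normalised gradient shrinker on a closed homotopy 4-sphere with Gaussian mass
`Z = ∫ e^{-f} dV ≥ 96π² e^{-2}` (density `Θ ≥ Θ(S⁴)`) has `Vol ≤ 96π² = Vol S⁴(√6)` (VOLCOMP♯, the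
volume comparison at the lifted threshold), THEN the round sphere is Θ-maximal with rigidity (ΘMAX♯):
every compact normalised shrinker on a closed homotopy 4-sphere has `Z ≤ 96π² e^{-2}`, and
`Z ≥ 96π² e^{-2}` forces `Hess f ≡ 0`. Proof: if `Z ≥ 96π²e^{-2}` then VOLCOMP♯ and the Jensen bound
`Z ≤ e^{-2} Vol` (p71839) give `Z ≤ e^{-2}Vol ≤ 96π²e^{-2} ≤ Z`, so `e^{-2}Vol ≤ Z`, hence `f ≡ 2`
(`helper_potentialEqTwo_of_jensenGe`) and `Hess f = Hess 2 = 0`; the bound itself follows the same way by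
contraposition. [cite: CaoHamiltonIlmanen2004, §4] [cite: ColdingIlmanenMinicozziWhite2013, Thm. 0.1] -/
theorem helper_thetaMaxSharp_of_volumeComparisonSharp :
    (∀ (M : Type) [TopologicalSpace M] [T2Space M] [SecondCountableTopology M]
      [ChartedSpace (EuclideanSpace ℝ (Fin 4)) M] [IsManifold (𝓡 4) ∞ M] [CompactSpace M]
      [T3Space M] [MeasurableSpace M] [BorelSpace M],
      M ≃ₕ Metric.sphere (0 : EuclideanSpace ℝ (Fin 5)) 1 →
    ∀ (g : Literature.Geometry.Lorentzian.PseudoRiemannianMetric (𝓡 4) ∞ (EuclideanSpace ℝ (Fin 4))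
        (TangentSpace (𝓡 4) : M → Type _)) [g.HasLeviCivita] (f : M → ℝ) (hg : g.IsRiemannian),
      ContMDiff (𝓡 4) 𝓘(ℝ, ℝ) ∞ f →
      (∀ (x : M) (X Y : TangentSpace (𝓡 4) x),
        g.ricci x X Y + g.hessian f x X Y = (1 / 2 : ℝ) * g.val x X Y) →
      (∀ x : M, g.scalarCurvature x + g.gradSq f x = f x) →
      ENNReal.ofReal (96 * Real.pi ^ 2 * Real.exp (-2)) ≤
        ∫⁻ x, ENNReal.ofReal (Real.exp (-f x))
          ∂(Literature.Geometry.Lorentzian.riemannianMeasure (g.toContMDiffRiemannianMetric hg)) →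
      ((Literature.Geometry.Lorentzian.riemannianMeasure (g.toContMDiffRiemannianMetric hg))
          Set.univ).toReal ≤ 96 * Real.pi ^ 2) →
    (∀ (M : Type) [TopologicalSpace M] [T2Space M] [SecondCountableTopology M]
      [ChartedSpace (EuclideanSpace ℝ (Fin 4)) M] [IsManifold (𝓡 4) ∞ M] [CompactSpace M]
      [T3Space M] [MeasurableSpace M] [BorelSpace M],
      M ≃ₕ Metric.sphere (0 : EuclideanSpace ℝ (Fin 5)) 1 →
    ∀ (g : Literature.Geometry.Lorentzian.PseudoRiemannianMetric (𝓡 4) ∞ (EuclideanSpace ℝ (Fin 4))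
        (TangentSpace (𝓡 4) : M → Type _)) [g.HasLeviCivita] (f : M → ℝ) (hg : g.IsRiemannian),
      ContMDiff (𝓡 4) 𝓘(ℝ, ℝ) ∞ f →
      (∀ (x : M) (X Y : TangentSpace (𝓡 4) x),
        g.ricci x X Y + g.hessian f x X Y = (1 / 2 : ℝ) * g.val x X Y) →
      (∀ x : M, g.scalarCurvature x + g.gradSq f x = f x) →
      (∫ x, Real.exp (-f x)
          ∂(Literature.Geometry.Lorentzian.riemannianMeasure (g.toContMDiffRiemannianMetric hg))) ≤
        96 * Real.pi ^ 2 * Real.exp (-2) ∧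
      (96 * Real.pi ^ 2 * Real.exp (-2) ≤
        ∫ x, Real.exp (-f x)
          ∂(Literature.Geometry.Lorentzian.riemannianMeasure (g.toContMDiffRiemannianMetric hg)) →
        ∀ (x : M) (X Y : TangentSpace (𝓡 4) x), g.hessian f x X Y = 0)) := by
  intro hVC M _ _ _ _ _ _ _ _ _ e g _ f hg hf hsol hnorm
  set μ := riemannianMeasure (g.toContMDiffRiemannianMetric hg) with hμ
  haveI : IsFiniteMeasure μ :=
    ⟨riemannianVolume_lt_top_of_isCompact_holds (g.toContMDiffRiemannianMetric hg) le_rfl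
      isCompact_univ⟩
  have hV : g.riemVolume = μ := PseudoRiemannianMetric.riemVolume_eq hg
  have hint : Integrable (fun x ↦ Real.exp (-f x)) μ := hV ▸ integrable_exp_neg_of_contMDiff hf
  have hJ := stub_jensenVolumeBound M g f hg hf hsol hnorm
  -- the key step: `Z ≥ 96π²e^{-2}` forces `e^{-2} Vol ≤ Z` (hence `f ≡ 2`) and `Vol ≤ 96π²`
  have key : 96 * Real.pi ^ 2 * Real.exp (-2) ≤ ∫ x, Real.exp (-f x) ∂μ →
      (μ univ).toReal ≤ 96 * Real.pi ^ 2 := by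
    intro hZ
    refine hVC M e g f hg hf hsol hnorm ?_
    rw [← ofReal_integral_eq_lintegral_ofReal hint (ae_of_all _ fun x ↦ (Real.exp_pos _).le)]
    exact ENNReal.ofReal_le_ofReal hZ
  refine ⟨?_, ?_⟩
  · by_contra hlt
    rw [not_le] at hlt
    have hvol := key hlt.le
    have : ∫ x, Real.exp (-f x) ∂μ ≤ 96 * Real.pi ^ 2 * Real.exp (-2) := by
      calc ∫ x, Real.exp (-f x) ∂μ ≤ Real.exp (-2) * (μ univ).toReal := hJ
        _ ≤ Real.exp (-2) * (96 * Real.pi ^ 2) :=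
            mul_le_mul_of_nonneg_left hvol (Real.exp_pos _).le
        _ = 96 * Real.pi ^ 2 * Real.exp (-2) := by ring
    linarith
  · intro hZ
    have hvol := key hZ
    have hge : Real.exp (-2) * (μ univ).toReal ≤ ∫ x, Real.exp (-f x) ∂μ := by
      calc Real.exp (-2) * (μ univ).toReal ≤ Real.exp (-2) * (96 * Real.pi ^ 2) :=
            mul_le_mul_of_nonneg_left hvol (Real.exp_pos _).le
        _ = 96 * Real.pi ^ 2 * Real.exp (-2) := by ring
        _ ≤ ∫ x, Real.exp (-f x) ∂μ := hZ
    have h2 : ∀ x, f x = 2 := helper_potentialEqTwo_of_jensenGe M g f hg hf hsol hnorm hge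
    have hfun : f = fun _ ↦ (2 : ℝ) := funext h2
    intro x X Y
    rw [hfun, hessian_const_four g 2 x]
    rfl

/-- **ΘMAX♯ ⇒ COMPACT♯ under Gursky's gap (registered helper `helper_compactSharp_of_thetaMaxSharp`).**
IF the round sphere is Θ-maximal with rigidity among compact normalised shrinkers on closed homotopy
4-spheres (ΘMAX♯: `Z ≤ 96π²e^{-2}`, and `Z ≥ 96π²e^{-2} ⇒ Hess f ≡ 0`), THEN every compact normalised
shrinker on a closed `M ≃ₕ S⁴` with `Z ≥ 96π² e^{-2}` lives on `M ≅ S⁴` (COMPACT♯): `Hess f ≡ 0`, the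
mass hypothesis dominates the crux's (`96π²e^{-2} > 32π²√π e^{-3/2}`), and the landed Einstein endgame
`helper_einsteinEndgameKillingHopf` (Gursky's gap on homotopy 4-spheres, the Jensen volume floor,
Killing–Hopf) applies. [cite: Gursky2000, Theorem 1] [cite: CaoHamiltonIlmanen2004, §4] -/
theorem helper_compactSharp_of_thetaMaxSharp :
    Literature.Geometry.Riemannian.gursky_einstein_homotopySphere_four →
    (∀ (M : Type) [TopologicalSpace M] [T2Space M] [SecondCountableTopology M]
      [ChartedSpace (EuclideanSpace ℝ (Fin 4)) M] [IsManifold (𝓡 4) ∞ M] [CompactSpace M]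
      [T3Space M] [MeasurableSpace M] [BorelSpace M],
      M ≃ₕ Metric.sphere (0 : EuclideanSpace ℝ (Fin 5)) 1 →
    ∀ (g : Literature.Geometry.Lorentzian.PseudoRiemannianMetric (𝓡 4) ∞ (EuclideanSpace ℝ (Fin 4))
        (TangentSpace (𝓡 4) : M → Type _)) [g.HasLeviCivita] (f : M → ℝ) (hg : g.IsRiemannian),
      ContMDiff (𝓡 4) 𝓘(ℝ, ℝ) ∞ f →
      (∀ (x : M) (X Y : TangentSpace (𝓡 4) x),
        g.ricci x X Y + g.hessian f x X Y = (1 / 2 : ℝ) * g.val x X Y) →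
      (∀ x : M, g.scalarCurvature x + g.gradSq f x = f x) →
      (∫ x, Real.exp (-f x)
          ∂(Literature.Geometry.Lorentzian.riemannianMeasure (g.toContMDiffRiemannianMetric hg))) ≤
        96 * Real.pi ^ 2 * Real.exp (-2) ∧
      (96 * Real.pi ^ 2 * Real.exp (-2) ≤
        ∫ x, Real.exp (-f x)
          ∂(Literature.Geometry.Lorentzian.riemannianMeasure (g.toContMDiffRiemannianMetric hg)) →
        ∀ (x : M) (X Y : TangentSpace (𝓡 4) x), g.hessian f x X Y = 0)) →
    (∀ (M : Type) [TopologicalSpace M] [T2Space M] [SecondCountableTopology M]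
      [ChartedSpace (EuclideanSpace ℝ (Fin 4)) M] [IsManifold (𝓡 4) ∞ M] [CompactSpace M]
      [T3Space M] [MeasurableSpace M] [BorelSpace M],
      M ≃ₕ Metric.sphere (0 : EuclideanSpace ℝ (Fin 5)) 1 →
    ∀ (g : Literature.Geometry.Lorentzian.PseudoRiemannianMetric (𝓡 4) ∞ (EuclideanSpace ℝ (Fin 4))
        (TangentSpace (𝓡 4) : M → Type _)) [g.HasLeviCivita] (f : M → ℝ) (hg : g.IsRiemannian),
      ContMDiff (𝓡 4) 𝓘(ℝ, ℝ) ∞ f →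
      (∀ (x : M) (X Y : TangentSpace (𝓡 4) x),
        g.ricci x X Y + g.hessian f x X Y = (1 / 2 : ℝ) * g.val x X Y) →
      (∀ x : M, g.scalarCurvature x + g.gradSq f x = f x) →
      ENNReal.ofReal (96 * Real.pi ^ 2 * Real.exp (-2)) ≤
        ∫⁻ x, ENNReal.ofReal (Real.exp (-f x))
          ∂(Literature.Geometry.Lorentzian.riemannianMeasure (g.toContMDiffRiemannianMetric hg)) →
      Nonempty (M ≃ₘ⟮𝓡 4, 𝓡 4⟯ Metric.sphere (0 : EuclideanSpace ℝ (Fin 5)) 1)) := by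
  intro hG hMax M _ _ _ _ _ _ _ _ _ e g _ f hg hf hsol hnorm hsharp
  set μ := riemannianMeasure (g.toContMDiffRiemannianMetric hg) with hμ
  haveI : IsFiniteMeasure μ :=
    ⟨riemannianVolume_lt_top_of_isCompact_holds (g.toContMDiffRiemannianMetric hg) le_rfl
      isCompact_univ⟩
  have hV : g.riemVolume = μ := PseudoRiemannianMetric.riemVolume_eq hg
  have hint : Integrable (fun x ↦ Real.exp (-f x)) μ := hV ▸ integrable_exp_neg_of_contMDiff hf
  have hlin : ∫⁻ x, ENNReal.ofReal (Real.exp (-f x)) ∂μ = ENNReal.ofReal (∫ x, Real.exp (-f x) ∂μ) :=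
    (ofReal_integral_eq_lintegral_ofReal hint (ae_of_all _ fun x ↦ (Real.exp_pos _).le)).symm
  have hZ : 96 * Real.pi ^ 2 * Real.exp (-2) ≤ ∫ x, Real.exp (-f x) ∂μ := by
    have h := hsharp
    rw [hlin, ENNReal.ofReal_le_ofReal_iff (integral_nonneg fun x ↦ (Real.exp_pos _).le)] at h
    exact h
  have hHess := (hMax M e g f hg hf hsol hnorm).2 hZ
  have hdens : ENNReal.ofReal (32 * Real.pi ^ 2 * Real.sqrt Real.pi * Real.exp (-(3 : ℝ) / 2)) <
      ∫⁻ x, ENNReal.ofReal (Real.exp (-f x)) ∂μ := by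
    rw [hlin, ENNReal.ofReal_lt_ofReal_iff']
    refine ⟨cylinderMass_lt_roundMass.trans_le hZ, ?_⟩
    exact lt_of_lt_of_le (by positivity) hZ
  exact helper_einsteinEndgameKillingHopf hG M e g f hg hf hsol hnorm hdens hHess

/-- **THE THRESHOLD-LIFT REDUCTION (registered helper `helper_thresholdLiftReduction`).** Under
Gursky's Einstein gap on homotopy 4-spheres (`hG`, one named fact): IF every compact normalised
gradient shrinker on a closed homotopy 4-sphere with `∫ e^{-f} dV ≥ 96π² e^{-2}` (`Θ ≥ Θ(S⁴)`) has
`Vol ≤ 96π²` (VOLCOMP♯ — Bishop-true in the Einstein case), THEN every such shrinker lives on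
`M ≅ S⁴` (COMPACT♯, the compact crux of route EntropyRung at the lifted cut `ν(g₀) ≥ log 6 − 2`).
Composition of `helper_thetaMaxSharp_of_volumeComparisonSharp` and
`helper_compactSharp_of_thetaMaxSharp`: no Chang–Gursky–Yang, no Chern–Gauss–Bonnet, no sup bound on
`R`, no certificate. [cite: Gursky2000, Theorem 1] [cite: CaoHamiltonIlmanen2004, §4]
[cite: ColdingIlmanenMinicozziWhite2013, Thm. 0.1] -/
theorem helper_thresholdLiftReduction :
    Literature.Geometry.Riemannian.gursky_einstein_homotopySphere_four →
    (∀ (M : Type) [TopologicalSpace M] [T2Space M] [SecondCountableTopology M]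
      [ChartedSpace (EuclideanSpace ℝ (Fin 4)) M] [IsManifold (𝓡 4) ∞ M] [CompactSpace M]
      [T3Space M] [MeasurableSpace M] [BorelSpace M],
      M ≃ₕ Metric.sphere (0 : EuclideanSpace ℝ (Fin 5)) 1 →
    ∀ (g : Literature.Geometry.Lorentzian.PseudoRiemannianMetric (𝓡 4) ∞ (EuclideanSpace ℝ (Fin 4))
        (TangentSpace (𝓡 4) : M → Type _)) [g.HasLeviCivita] (f : M → ℝ) (hg : g.IsRiemannian),
      ContMDiff (𝓡 4) 𝓘(ℝ, ℝ) ∞ f →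
      (∀ (x : M) (X Y : TangentSpace (𝓡 4) x),
        g.ricci x X Y + g.hessian f x X Y = (1 / 2 : ℝ) * g.val x X Y) →
      (∀ x : M, g.scalarCurvature x + g.gradSq f x = f x) →
      ENNReal.ofReal (96 * Real.pi ^ 2 * Real.exp (-2)) ≤
        ∫⁻ x, ENNReal.ofReal (Real.exp (-f x))
          ∂(Literature.Geometry.Lorentzian.riemannianMeasure (g.toContMDiffRiemannianMetric hg)) →
      ((Literature.Geometry.Lorentzian.riemannianMeasure (g.toContMDiffRiemannianMetric hg))
          Set.univ).toReal ≤ 96 * Real.pi ^ 2) →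
    (∀ (M : Type) [TopologicalSpace M] [T2Space M] [SecondCountableTopology M]
      [ChartedSpace (EuclideanSpace ℝ (Fin 4)) M] [IsManifold (𝓡 4) ∞ M] [CompactSpace M]
      [T3Space M] [MeasurableSpace M] [BorelSpace M],
      M ≃ₕ Metric.sphere (0 : EuclideanSpace ℝ (Fin 5)) 1 →
    ∀ (g : Literature.Geometry.Lorentzian.PseudoRiemannianMetric (𝓡 4) ∞ (EuclideanSpace ℝ (Fin 4))
        (TangentSpace (𝓡 4) : M → Type _)) [g.HasLeviCivita] (f : M → ℝ) (hg : g.IsRiemannian),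
      ContMDiff (𝓡 4) 𝓘(ℝ, ℝ) ∞ f →
      (∀ (x : M) (X Y : TangentSpace (𝓡 4) x),
        g.ricci x X Y + g.hessian f x X Y = (1 / 2 : ℝ) * g.val x X Y) →
      (∀ x : M, g.scalarCurvature x + g.gradSq f x = f x) →
      ENNReal.ofReal (96 * Real.pi ^ 2 * Real.exp (-2)) ≤
        ∫⁻ x, ENNReal.ofReal (Real.exp (-f x))
          ∂(Literature.Geometry.Lorentzian.riemannianMeasure (g.toContMDiffRiemannianMetric hg)) →
      Nonempty (M ≃ₘ⟮𝓡 4, 𝓡 4⟯ Metric.sphere (0 : EuclideanSpace ℝ (Fin 5)) 1)) :=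
  fun hG hVC ↦ helper_compactSharp_of_thetaMaxSharp hG
    (helper_thetaMaxSharp_of_volumeComparisonSharp hVC)

/-- **The lifted crux is weaker than the crux (registered helper
`helper_compactSharp_of_compactShrinkerGap`).** `EntropyRung.CompactShrinkerGap → COMPACT♯`: the mass
hypothesis `∫⁻ e^{-f} ≥ 96π² e^{-2}` of COMPACT♯ implies the crux's `∫⁻ e^{-f} > 32π²√π e^{-3/2}`
(`cylinderMass_lt_roundMass`). [cite: CaoHamiltonIlmanen2004, §4] -/
theorem helper_compactSharp_of_compactShrinkerGap :
    Summit.SmoothPoincare4.SmoothPoincare4.Theses.EntropyRung.CompactShrinkerGap →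
    (∀ (M : Type) [TopologicalSpace M] [T2Space M] [SecondCountableTopology M]
      [ChartedSpace (EuclideanSpace ℝ (Fin 4)) M] [IsManifold (𝓡 4) ∞ M] [CompactSpace M]
      [T3Space M] [MeasurableSpace M] [BorelSpace M],
      M ≃ₕ Metric.sphere (0 : EuclideanSpace ℝ (Fin 5)) 1 →
    ∀ (g : Literature.Geometry.Lorentzian.PseudoRiemannianMetric (𝓡 4) ∞ (EuclideanSpace ℝ (Fin 4))
        (TangentSpace (𝓡 4) : M → Type _)) [g.HasLeviCivita] (f : M → ℝ) (hg : g.IsRiemannian),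
      ContMDiff (𝓡 4) 𝓘(ℝ, ℝ) ∞ f →
      (∀ (x : M) (X Y : TangentSpace (𝓡 4) x),
        g.ricci x X Y + g.hessian f x X Y = (1 / 2 : ℝ) * g.val x X Y) →
      (∀ x : M, g.scalarCurvature x + g.gradSq f x = f x) →
      ENNReal.ofReal (96 * Real.pi ^ 2 * Real.exp (-2)) ≤
        ∫⁻ x, ENNReal.ofReal (Real.exp (-f x))
          ∂(Literature.Geometry.Lorentzian.riemannianMeasure (g.toContMDiffRiemannianMetric hg)) →
      Nonempty (M ≃ₘ⟮𝓡 4, 𝓡 4⟯ Metric.sphere (0 : EuclideanSpace ℝ (Fin 5)) 1)) := by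
  intro hC M _ _ _ _ _ _ _ _ _ e g _ f hg hf hsol hnorm hsharp
  refine hC M e g f hg hf hsol hnorm (lt_of_lt_of_le ?_ hsharp)
  rw [ENNReal.ofReal_lt_ofReal_iff']
  exact ⟨cylinderMass_lt_roundMass, by positivity⟩

/-- **VOLCOMP♯ is weaker than the registered VolumeComparison (registered helper
`helper_volumeComparisonSharp_of_volumeComparison`).** The registered STUB 24
`stub_volumeComparison` of line `cgy-variance-pivot` (`Vol ≤ 96π²` for the crux data, density above
`Θ(S³×ℝ)`) implies VOLCOMP♯ (`Vol ≤ 96π²` for data with `∫⁻ e^{-f} ≥ 96π²e^{-2}`), again by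
`cylinderMass_lt_roundMass`. [cite: CaoHamiltonIlmanen2004, §4] -/
theorem helper_volumeComparisonSharp_of_volumeComparison :
    (∀ (M : Type) [TopologicalSpace M] [T2Space M] [SecondCountableTopology M]
      [ChartedSpace (EuclideanSpace ℝ (Fin 4)) M] [IsManifold (𝓡 4) ∞ M] [CompactSpace M]
      [T3Space M] [MeasurableSpace M] [BorelSpace M],
      M ≃ₕ Metric.sphere (0 : EuclideanSpace ℝ (Fin 5)) 1 →
    ∀ (g : Literature.Geometry.Lorentzian.PseudoRiemannianMetric (𝓡 4) ∞ (EuclideanSpace ℝ (Fin 4))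
        (TangentSpace (𝓡 4) : M → Type _)) [g.HasLeviCivita] (f : M → ℝ) (hg : g.IsRiemannian),
      ContMDiff (𝓡 4) 𝓘(ℝ, ℝ) ∞ f →
      (∀ (x : M) (X Y : TangentSpace (𝓡 4) x),
        g.ricci x X Y + g.hessian f x X Y = (1 / 2 : ℝ) * g.val x X Y) →
      (∀ x : M, g.scalarCurvature x + g.gradSq f x = f x) →
      ENNReal.ofReal (32 * Real.pi ^ 2 * Real.sqrt Real.pi * Real.exp (-(3 : ℝ) / 2)) <
        ∫⁻ x, ENNReal.ofReal (Real.exp (-f x))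
          ∂(Literature.Geometry.Lorentzian.riemannianMeasure (g.toContMDiffRiemannianMetric hg)) →
      ((Literature.Geometry.Lorentzian.riemannianMeasure (g.toContMDiffRiemannianMetric hg))
          Set.univ).toReal ≤ 96 * Real.pi ^ 2) →
    (∀ (M : Type) [TopologicalSpace M] [T2Space M] [SecondCountableTopology M]
      [ChartedSpace (EuclideanSpace ℝ (Fin 4)) M] [IsManifold (𝓡 4) ∞ M] [CompactSpace M]
      [T3Space M] [MeasurableSpace M] [BorelSpace M],
      M ≃ₕ Metric.sphere (0 : EuclideanSpace ℝ (Fin 5)) 1 →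
    ∀ (g : Literature.Geometry.Lorentzian.PseudoRiemannianMetric (𝓡 4) ∞ (EuclideanSpace ℝ (Fin 4))
        (TangentSpace (𝓡 4) : M → Type _)) [g.HasLeviCivita] (f : M → ℝ) (hg : g.IsRiemannian),
      ContMDiff (𝓡 4) 𝓘(ℝ, ℝ) ∞ f →
      (∀ (x : M) (X Y : TangentSpace (𝓡 4) x),
        g.ricci x X Y + g.hessian f x X Y = (1 / 2 : ℝ) * g.val x X Y) →
      (∀ x : M, g.scalarCurvature x + g.gradSq f x = f x) →
      ENNReal.ofReal (96 * Real.pi ^ 2 * Real.exp (-2)) ≤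
        ∫⁻ x, ENNReal.ofReal (Real.exp (-f x))
          ∂(Literature.Geometry.Lorentzian.riemannianMeasure (g.toContMDiffRiemannianMetric hg)) →
      ((Literature.Geometry.Lorentzian.riemannianMeasure (g.toContMDiffRiemannianMetric hg))
          Set.univ).toReal ≤ 96 * Real.pi ^ 2) := by
  intro h24 M _ _ _ _ _ _ _ _ _ e g _ f hg hf hsol hnorm hsharp
  refine h24 M e g f hg hf hsol hnorm (lt_of_lt_of_le ?_ hsharp)
  rw [ENNReal.ofReal_lt_ofReal_iff']
  exact ⟨cylinderMass_lt_roundMass, by positivity⟩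

end Summit.SmoothPoincare4.SmoothPoincare4.Theorems

end
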